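import Summits.NavierStokesRegularity.NavierStokesRegularity.Theorems.FrequencyRigidity.Negative.BreathingSwirlObjects

/-!
# `FrequencyRigidity` (crux `stmt-NavierStokesRegularity-2955`, route `AdaptedFrequency`):
# (R) the breathing two-shell swirl — KINEMATICS and `Λ ≡ 2` (file 2 of 4)

`AdaptedFrequency.FrequencyRigidity = ¬ ∃ (ν C Λ₀ v q K), …`: no smooth ancient Navier–Stokes
flow on `ℝ³ × (−∞,0)` with the GLOBAL Type-I bound, an adapted two-sided Gaussian-comparable
kernel `K` at `(0,0)`, positive adapted enstrophy `H` and constant adapted frequency `Λ ≡ Λ₀`.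
No `¬`-theorem of the crux is claimed (a witness contains a non-trivial bounded ancient mild
solution with two-ended Type-I decay — open; see `Cruxes/FrequencyRigidity/Disproof.lean`).
Series (R) of the negative-side support files (after `Clauses`, `RigidRotation`,
`FrequencyStructure`, `SelfSimilarSwirl`, `SmallLocalTypeI`) refutes the INFERENCE "constant
adapted frequency ⇒ (rotated) self-similar" at the level of everything except the momentum
equation, by ONE explicit field, the BREATHING TWO-SHELL SWIRL
`breath ν t x = (−t)^{−1/2} W_t(x/√(−t))`, `W_t = a(t)V + b(t)V₂`, `a = √A₂ cos log(−t)`,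
`b = √A₁ sin log(−t)`, inner profile `V = χ·(e₃ × ·)` (support `‖y‖² ≤ 2`), outer profile
`V₂ = ψ·(e₃ × ·)` (support `3 ≤ ‖y‖² ≤ 8`), `Aᵢ` the Gaussian enstrophies of the two profiles:
smooth, divergence-free, GLOBAL Type-I, heat kernel adapted, `H(t) = A₁A₂/t²` EXACTLY (`Λ ≡ 2`),
centred, scale-invariant bounds, steady/covariant/slaved kernel — yet NOT backward self-similar
(it is `e^{π}`-DSS and the half-turn dilation flips its sign) and NOT a rotating wave
`pvAnsatz α U₀` for any `α`.  Files: `BreathingSwirlObjects` (all definitions,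
profile calculus), `BreathingSwirl` (kinematics, `H = A₁A₂/t²`, `Λ ≡ 2`), `BreathingSwirlNonRigid`
((R1) not self-similar, (R2) not a rotating wave), `BreathingSwirlNormalForm` ((R3) the normal-form
clauses of line `kernel-fading-memory` hold kinematically; `kinematic_canonical_witness`).

This file: `breath ν` is jointly smooth on `(−∞,0) × ℝ³`, divergence-free, obeys the GLOBAL
Type-I bound with constant `Cb`, is tangent to the spheres about the pole (so the backward heat
kernel satisfies the five kernel clauses for it, `kernelClauses_backwardHeatKernel`) and is odd;
`curl (breath t) = (−t)⁻¹(curl W_t)(·/√(−t))`; the outer Gaussian enstrophy `A₂ = ∫F₂ > 0`;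
**`adaptedEnstrophy_breath`: `H(t) = ∫‖curl breath(t)‖²K(t) = A₁A₂/t²` EXACTLY** (parabolic
scaling of the Bochner integral + disjoint supports + `a²A₁ + b²A₂ = A₁A₂(cos² + sin²)`), hence
`freqClause_breath` (`H > 0`, `Λ ≡ 2`) and `breath_inhabits_withoutMomentum` — a second, NOT
self-similar inhabitant of the variant `FrequencyRigidityWithoutMomentum` of file
`SelfSimilarSwirl` ((C): the momentum equation is load-bearing).

CONSEQUENCES FOR PROVERS (with files 3–4).  (i) "Constant `Λ` is the equality case of
log-convexity ⇒ `∂_σω̃ ∥ ω̃` ⇒ self-similar modulo wobble" (crux docstring) is false as a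
kinematic/kernel-structural inference: here `Λ ≡ 2`, the gauge is centred (no wobble) and
`∂_σω̃ ⊥ ω̃`, `ω̃` rotating in `L²(G_ν)` between two orthogonal profiles; rigidity must come from
the momentum equation (head law / torque law / Liouville).  (ii) The lines' normalisations
(centring, pinning `Λ₀ = 2`, flatness `H = A(−t)^{−2}`, kernel steadiness/covariance/slaving)
exclude nothing by themselves.  (iii) Slaving has no converse: an unsteady flow may carry a
steady canonical kernel.  (iv) A `λ`-DSS flow can have EXACTLY flat `t²H`: `Λ` alone does not
detect discrete self-similarity.

## References

* B. Pineau, V. Vicol, arXiv:2607.09619 (2026), (1.7), Conj. 1.1, Thm 1.4. [PineauVicol2026]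
* Z. Bradshaw, T.-P. Tsai, Comm. PDE 42 (2017), §5 OP 5.1–5.2. [BradshawTsai2017CPDE]
* D. Chae, J. Wolf, arXiv:1610.09464, Thm 1.3. [ChaeWolf2017RemovingDSS]
* T.-P. Tsai, Arch. Ration. Mech. Anal. 143 (1998) 29–51, Thm 1. [Tsai1998]
* G. Koch, N. Nadirashvili, G. Seregin, V. Šverák, Acta Math. 203 (2009) 83–105.
  [KochNadirashviliSereginSverak2009]
-/

noncomputable section

set_option linter.dupNamespace false

namespace Summit.NavierStokesRegularity.NavierStokesRegularity.Theorems.FrequencyRigidity.Negative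

open Literature.Analysis.FluidPDE Literature.Analysis.UnboundedOperators
open MeasureTheory Set Filter Topology Function
open scoped Laplacian InnerProductSpace RealInnerProductSpace ContDiff

/-! ### The breathing swirl: kinematics -/

/-- `|a(t)| ≤ √A₂`. -/
theorem abs_amp₁_le (ν t : ℝ) : |amp₁ ν t| ≤ Real.sqrt (∫ y, F₂ ν y) := by
  rw [amp₁, abs_mul, abs_of_nonneg (Real.sqrt_nonneg _)]
  exact mul_le_of_le_one_right (Real.sqrt_nonneg _) (Real.abs_cos_le_one _)

/-- `|b(t)| ≤ √A₁`. -/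
theorem abs_amp₂_le (ν t : ℝ) : |amp₂ ν t| ≤ Real.sqrt (∫ y, F ν y) := by
  rw [amp₂, abs_mul, abs_of_nonneg (Real.sqrt_nonneg _)]
  exact mul_le_of_le_one_right (Real.sqrt_nonneg _) (Real.abs_sin_le_one _)

/-- The breathing swirl is jointly smooth on `(−∞,0) × ℝ³`. -/
theorem isSmoothSpaceTimeOn_breath (ν : ℝ) : IsSmoothSpaceTimeOn (Iio 0) (breath ν) := by
  rintro ⟨t, x⟩ ⟨ht, -⟩
  apply ContDiffAt.contDiffWithinAt
  have ht' : t < 0 := ht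
  have hsc : ContDiffAt ℝ ∞ (fun p : ℝ × E3 => sc p.1) (t, x) :=
    ContDiffAt.comp (t, x) (g := sc) (f := Prod.fst) (sc_contDiffAt ht') contDiffAt_fst
  have hlog : ContDiffAt ℝ ∞ (fun p : ℝ × E3 => Real.log (-p.1)) (t, x) :=
    (Real.contDiffAt_log.2 (by linarith : -t ≠ 0)).comp (t, x) contDiffAt_fst.neg
  have ha : ContDiffAt ℝ ∞ (fun p : ℝ × E3 => amp₁ ν p.1) (t, x) := contDiffAt_const.mul hlog.cos
  have hb : ContDiffAt ℝ ∞ (fun p : ℝ × E3 => amp₂ ν p.1) (t, x) := contDiffAt_const.mul hlog.sin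
  have hy : ContDiffAt ℝ ∞ (fun p : ℝ × E3 => sc p.1 • p.2) (t, x) := hsc.smul contDiffAt_snd
  have hV : ContDiffAt ℝ ∞ (fun p : ℝ × E3 => V (sc p.1 • p.2)) (t, x) :=
    (V_contDiff (n := ⊤)).contDiffAt.comp (t, x) hy
  have hV₂ : ContDiffAt ℝ ∞ (fun p : ℝ × E3 => V₂ (sc p.1 • p.2)) (t, x) :=
    (V₂_contDiff (n := ⊤)).contDiffAt.comp (t, x) hy
  exact hsc.smul ((ha.smul hV).add (hb.smul hV₂))

/-- The breathing swirl is divergence-free at every time. -/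
theorem isDivFree_breath (ν t : ℝ) : VectorCalculus.IsDivFree (breath ν t) := by
  intro x
  show VectorCalculus.divergence (fun z => sc t • Wb ν t (sc t • z)) x = 0
  rw [divergence_smul_comp_smul _ _ (hasFDerivAt_Wb ν t _).differentiableAt, divergence_Wb,
    mul_zero]

/-- The breathing swirl obeys the GLOBAL Type-I bound with constant `C_b`. -/
theorem typeIBound_breath (ν : ℝ) : TypeIBound (Cb ν) (breath ν) := by
  intro t ht x
  have hsc := sc_pos (neg_pos.2 (show t < 0 from ht))
  rw [breath, norm_smul, Real.norm_of_nonneg hsc.le, sc, div_eq_mul_inv, mul_comm]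
  refine mul_le_mul_of_nonneg_right ((norm_Wb_le ν t _).trans ?_) (inv_nonneg.2 (Real.sqrt_nonneg _))
  have h1 := abs_amp₁_le ν t
  have h2 := abs_amp₂_le ν t
  rw [Cb]
  linarith

/-- The breathing swirl is tangent to the spheres about the origin. -/
theorem inner_self_breath (ν t : ℝ) (x : E3) : ⟪x, breath ν t x⟫ = 0 := by
  rw [breath, inner_smul_right]
  rcases eq_or_ne (sc t) 0 with h | h
  · simp [h]
  · have := inner_self_Wb ν t (sc t • x)
    rw [inner_smul_left] at this
    simp only [conj_trivial, mul_eq_zero, h, false_or] at this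
    rw [this, mul_zero]

/-- The breathing swirl is odd in space. -/
theorem breath_neg (ν t : ℝ) (x : E3) : breath ν t (-x) = -breath ν t x := by
  rw [breath, breath, smul_neg, Wb_neg, smul_neg]

/-- Scaling of the vorticity: `curl (breath t)(x) = (−t)⁻¹ (curl W_t)(x/√(−t))`. -/
theorem curl_breath (ν t : ℝ) (x : E3) :
    curl (breath ν t) x = (sc t * sc t) • curl (Wb ν t) (sc t • x) :=
  curl_smul_comp_smul (sc t) x (hasFDerivAt_Wb ν t _).differentiableAt

/-! ### The breathing swirl: exact power-law enstrophy `H = A₁A₂/t²`, `Λ ≡ 2` -/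

/-- The inner profile enstrophy density is integrable. -/
theorem integrable_F (ν : ℝ) : Integrable (F ν) :=
  (continuous_F ν).integrable_of_hasCompactSupport (hasCompactSupport_F ν)

/-- The outer profile enstrophy density is continuous. -/
theorem continuous_F₂ (ν : ℝ) : Continuous (F₂ ν) :=
  ((continuous_curl (V₂_contDiff (n := 1))).norm.pow 2).mul (continuous_heatKernel ν)

/-- The outer profile enstrophy density has compact support. -/
theorem hasCompactSupport_F₂ (ν : ℝ) : HasCompactSupport (F₂ ν) := by
  have h1 : HasCompactSupport fun y => ‖curl V₂ y‖ ^ 2 :=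
    (hasCompactSupport_curl hasCompactSupport_V₂).norm.comp_left (g := fun r : ℝ => r ^ 2) (by simp)
  show HasCompactSupport ((fun y => ‖curl V₂ y‖ ^ 2) * heatKernel ν)
  exact h1.mul_right

/-- The outer profile enstrophy density is integrable. -/
theorem integrable_F₂ (ν : ℝ) : Integrable (F₂ ν) :=
  (continuous_F₂ ν).integrable_of_hasCompactSupport (hasCompactSupport_F₂ ν)

/-- The outer profile enstrophy density is nonnegative. -/
theorem F₂_nonneg {ν : ℝ} (hν : 0 < ν) (y : E3) : 0 ≤ F₂ ν y :=
  mul_nonneg (sq_nonneg _) (heatKernel_pos hν _).le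

/-- The outer profile enstrophy density does not vanish at `y₀`. -/
theorem F₂_y₀_ne {ν : ℝ} (hν : 0 < ν) : F₂ ν y₀ ≠ 0 := by
  have h1 : ‖curl V₂ y₀‖ ^ 2 = 4 := by
    rw [curl_V₂_y₀, norm_smul, e₃, PiLp.norm_single]
    norm_num
  rw [F₂, h1]
  exact mul_ne_zero (by norm_num) (heatKernel_pos hν _).ne'

/-- `A₂ = ∫ F₂ > 0`: the outer profile enstrophy is positive. -/
theorem integral_F₂_pos {ν : ℝ} (hν : 0 < ν) : 0 < ∫ y, F₂ ν y :=
  (continuous_F₂ ν).integral_pos_of_hasCompactSupport_nonneg_nonzero (hasCompactSupport_F₂ ν)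
    (F₂_nonneg hν) (F₂_y₀_ne hν)

/-- The breathing profile enstrophy density splits. -/
theorem Fb_eq (ν t : ℝ) (y : E3) : Fb ν t y = amp₁ ν t ^ 2 * F ν y + amp₂ ν t ^ 2 * F₂ ν y := by
  rw [Fb, norm_curl_Wb_sq, F, F₂]
  ring

/-- … and so does its integral. -/
theorem integral_Fb (ν t : ℝ) :
    ∫ y, Fb ν t y = amp₁ ν t ^ 2 * (∫ y, F ν y) + amp₂ ν t ^ 2 * (∫ y, F₂ ν y) := by
  simp_rw [Fb_eq]
  rw [integral_add ((integrable_F ν).const_mul _) ((integrable_F₂ ν).const_mul _),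
    integral_const_mul, integral_const_mul]

/-- `a(t)² A₁ + b(t)² A₂ = A₁ A₂` (`cos² + sin² = 1`): the profile enstrophy is CONSTANT in `t`. -/
theorem amp_sq_combination {ν : ℝ} (hν : 0 < ν) (t : ℝ) :
    amp₁ ν t ^ 2 * (∫ y, F ν y) + amp₂ ν t ^ 2 * (∫ y, F₂ ν y) = (∫ y, F ν y) * (∫ y, F₂ ν y) := by
  rw [amp₁, amp₂, mul_pow, mul_pow, Real.sq_sqrt (integral_F₂_pos hν).le,
    Real.sq_sqrt (integral_F_pos hν).le]
  linear_combination (∫ y, F ν y) * (∫ y, F₂ ν y) * Real.cos_sq_add_sin_sq (Real.log (-t))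

/-- **Exact power law**: the adapted enstrophy of the breathing swirl against the backward heat
kernel is `H(t) = A₁A₂ / t²` — constant adapted frequency `Λ ≡ 2`, although the profile `W_t`
is NOT constant in `t`. -/
theorem adaptedEnstrophy_breath {ν : ℝ} (hν : 0 < ν) {t : ℝ} (ht : t < 0) :
    (∫ x, ‖curl (breath ν t) x‖ ^ 2 * backwardHeatKernel ν 0 (0:E3) t x) =
      ((∫ y, F ν y) * (∫ y, F₂ ν y)) / t ^ 2 := by
  have hsc := sc_pos (neg_pos.2 ht)
  have h1 : ∀ x, ‖curl (breath ν t) x‖ ^ 2 * backwardHeatKernel ν 0 (0:E3) t x =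
      sc t ^ 7 * Fb ν t (sc t • x) := fun x => by
    rw [curl_breath, backwardHeatKernel_scaling hν ht, norm_smul, Fb,
      Real.norm_of_nonneg (mul_pos hsc hsc).le]
    ring
  simp_rw [h1, integral_const_mul]
  rw [Measure.integral_comp_smul volume (Fb ν t) (sc t)]
  simp only [finrank_euclideanSpace_fin, smul_eq_mul]
  rw [abs_of_pos (inv_pos.2 (pow_pos hsc 3)), integral_Fb, amp_sq_combination hν,
    div_eq_mul_inv, ← sc_pow_four ht]
  field_simp

/-- The frequency clause holds for the breathing swirl with `Λ₀ = 2` (`H = A₁A₂/t²`, `A₁A₂ > 0`). -/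
theorem freqClause_breath {ν : ℝ} (hν : 0 < ν) :
    FreqClause (breath ν) (backwardHeatKernel ν 0 (0:E3)) 2 := by
  intro H Λ hH hΛ
  set A : ℝ := (∫ y, F ν y) * (∫ y, F₂ ν y) with hA
  have hApos : 0 < A := mul_pos (integral_F_pos hν) (integral_F₂_pos hν)
  have hHt : ∀ t ∈ Iio (0:ℝ), H t = A / t ^ 2 := fun t ht => by
    rw [hH]; exact adaptedEnstrophy_breath hν ht
  refine ⟨fun t ht => ?_, fun t ht => ?_⟩
  · rw [hHt t ht]
    have ht0 : t ≠ 0 := ne_of_lt ht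
    positivity
  · have ht0 : t ≠ 0 := ne_of_lt ht
    have hev : H =ᶠ[𝓝 t] fun s => A * (s ^ 2)⁻¹ :=
      Filter.eventuallyEq_of_mem (Iio_mem_nhds ht) fun s hs => by
        rw [hHt s hs, div_eq_mul_inv]
    have hd : HasDerivAt (fun s : ℝ => A * (s ^ 2)⁻¹) (A * (-(2 * t) / (t ^ 2) ^ 2)) t := by
      have h1 : HasDerivAt (fun s : ℝ => s ^ 2) (2 * t) t := by simpa using hasDerivAt_pow 2 t
      exact (h1.inv (pow_ne_zero 2 ht0)).const_mul A
    rw [hΛ]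
    dsimp only
    rw [hev.deriv_eq, hd.deriv, hHt t ht]
    field_simp
    ring

/-- **(R, inhabitant)** The breathing swirl inhabits the `∃`-body of the crux with the momentum
equation dropped (`FrequencyRigidityWithoutMomentum` of (C)): jointly smooth, divergence-free,
GLOBAL Type-I, heat kernel adapted and comparable, `H > 0`, `Λ ≡ 2`. -/
theorem breath_inhabits_withoutMomentum {ν : ℝ} (hν : 0 < ν) :
    IsSmoothSpaceTimeOn (Iio 0) (breath ν) ∧ (∀ t ∈ Iio (0:ℝ), VectorCalculus.IsDivFree (breath ν t)) ∧
      TypeIBound (Cb ν) (breath ν) ∧ KernelClauses ν (breath ν) (backwardHeatKernel ν 0 (0:E3)) ∧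
      Comparable (backwardHeatKernel ν 0 (0:E3)) ∧ FreqClause (breath ν) (backwardHeatKernel ν 0 (0:E3)) 2 :=
  ⟨isSmoothSpaceTimeOn_breath ν, fun t _ => isDivFree_breath ν t, typeIBound_breath ν,
    kernelClauses_backwardHeatKernel hν _ (fun t _ x => inner_self_breath ν t x),
    comparable_backwardHeatKernel hν, freqClause_breath hν⟩

end Summit.NavierStokesRegularity.NavierStokesRegularity.Theorems.FrequencyRigidity.Negative
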